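import Mathlib.Topology.Algebra.Group.Basic
import Mathlib.Topology.Algebra.ContinuousMonoidHom
import Mathlib.Topology.Bases
import Mathlib.GroupTheory.Torsion
import Mathlib.GroupTheory.QuotientGroup.Defs
import Mathlib.Algebra.Group.Subgroup.ZPowers.Basic
import Mathlib.CategoryTheory.Action.Concrete
import Mathlib.CategoryTheory.ObjectProperty.FullSubcategory
import Mathlib.CategoryTheory.Equivalence
import Mathlib.CategoryTheory.Limits.Preserves.Finite
import Mathlib.CategoryTheory.Countable
import HarnessLib

/-!
# [IUTchI] §0 Notations and Conventions — pseudo-monoids, `B^temp(Π)`, tempered groups, temperoids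

Mochizuki, *Inter-universal Teichmüller theory I: construction of Hodge theaters*,
kurims manuscript (May 2020), §0 "Notations and Conventions", paragraph **Monoids and
Categories**, kurims pp. 33–35 [cite: Mochizuki2012, §0 pp.33-35] (D-0012 claim key, series
status DISPUTED; the conventions recorded here are plain algebra / topology and take no side).

Typed here, one declaration per printed notion:

* topological pseudo-monoids, pseudo-monoids, the underlying pseudo-monoid, divisible and
  cyclotomic pseudo-monoids (p. 33) — `PartialMul`, `PartialMul.IsRealizedBy`,
  `IsTopologicalPseudoMonoid`, `IsPseudoMonoid`, `IsDivisible`, `IsCyclotomic`;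
* `B^temp(Π)`: countable discrete sets with a continuous `Π`-action and `Π`-equivariant maps
  (p. 34; [SemiAnbd] §3) — `bTempProperty`, `BTemp`;
* tempered topological groups ("an inverse limit of an inverse system of surjections of countable
  discrete topological groups", p. 34; [SemiAnbd] Def. 3.1 (i)) — `SurjectiveSystem`,
  `SurjectiveSystem.limit`, `IsTempered`;
* connected temperoids (p. 34; [SemiAnbd] Def. 3.1 (ii)) — `IsConnectedTemperoid`;
* Galois-countable tempered groups (Remark 2.5.3 (i) (T1), p. 52, used on p. 34) —
  `IsGaloisCountable`;
* morphisms of connected temperoids `C₁ → C₂` := isomorphism classes of functors `C₂ → C₁`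
  preserving finite limits and countable colimits (p. 35; "differs — but only slightly! — from
  [SemiAnbd] Def. 3.1 (iii)") — `IsTemperoidMorphismFunctor`, `temperoidFunctorSetoid`,
  `TemperoidHom`;
* the pull-back functor `B^temp(Π₂) → B^temp(Π₁)` of a continuous homomorphism `Π₁ → Π₂`, i.e. the
  map (a) → (b) of the correspondence recalled on p. 35 — `BTemp.res`.

INTERFACE NOTE (TODO-merge:abc-iut-L3-t2): tempered groups / temperoids are [SemiAnbd] Def. 3.1,
owned in this campaign by seat abc-iut-L3-t2 (`Literature/AnabelianGeometry/SemiGraphs/`); IUTchI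
§0 re-prints the definitions verbatim, so they are typed here self-containedly and will be
reconciled (one side re-exporting the other) when that file lands.

Deliberately NOT here (named facts belonging to other seats, or prose): the reconstruction of
`Π` up to inner automorphism from `B^temp(Π)` (p. 34, via Remark 2.5.3 (i) (T5)) and the natural
bijection (a) ↔ (b) ↔ (c) between continuous outer homomorphisms and morphisms of (connected
parts of) temperoids (p. 35; = [SemiAnbd] Prop. 3.2, seat abc-iut-L3-t2); the equivalence
`C ≃ (C⁰)^⊤` for a connected temperoid and morphisms `C₁⁰ → C₂⁰` (p. 35, prose over [FrdI] §0);
`B(X)` for a generically scheme-like algebraic stack and `B(A) := B(Spec A)` (p. 34 — the étale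
π₁ interface, seat abc-iut-L4-t1).  No printed statement is strengthened.
-/

namespace Literature.IUT.HodgeTheaters

open CategoryTheory Topology

universe w v u

/-! ### Pseudo-monoids (p. 33) -/

section PseudoMonoids

/-- The raw datum underlying a (topological) pseudo-monoid: a set `P` "equipped with a map
`P × P ⊇ S → P`" (IUTchI §0 p. 33) — a partially defined binary operation with domain `S`.
[cite: Mochizuki2012, §0 p.33] -/
structure PartialMul (P : Type u) where
  /-- the domain `S ⊆ P × P` of the operation -/
  dom : Set (P × P)
  /-- the operation `S → P` -/
  op : dom → P

variable {P : Type u}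

/-- `(M, ι)` *realises* the partial multiplication on `P` (IUTchI §0 p. 33): `ι : P ↪ M` is an
injection into an abelian group `M` [written multiplicatively] such that
`S = {(a, b) ∈ P × P | ι(a) · ι(b) ∈ ι(P)}` and `S → P` is obtained by restricting the group
operation of `M` to `P` by means of `ι`. [cite: Mochizuki2012, §0 p.33] -/
structure PartialMul.IsRealizedBy (μ : PartialMul P) (M : Type u) [CommGroup M] (ι : P → M) :
    Prop where
  /-- `ι` is an embedding of sets -/
  injective : Function.Injective ι
  /-- the domain is exactly the set of pairs whose product stays in `ι(P)` -/
  dom_eq : μ.dom = {p | ι p.1 * ι p.2 ∈ Set.range ι}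
  /-- the operation is the restriction of the group law -/
  op_eq : ∀ p : μ.dom, ι (μ.op p) = ι p.1.1 * ι p.1.2

/-- `P` [with the datum `μ`] is a *pseudo-monoid*: some abelian group `M` with the DISCRETE
topology and some injection `ι : P ↪ M` realise `μ` (IUTchI §0 p. 33).
[cite: Mochizuki2012, §0 p.33] -/
def PartialMul.IsPseudoMonoid (μ : PartialMul P) : Prop :=
  ∃ (M : Type u) (_ : CommGroup M) (ι : P → M), μ.IsRealizedBy M ι

/-- A topological space `P` equipped with `μ` is a *topological pseudo-monoid* if there exist a
topological abelian group `M` and an embedding of topological spaces `ι : P ↪ M` realising `μ`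
(IUTchI §0 p. 33).  [The printed datum is "a continuous map `P × P ⊇ S → P`"; continuity of
`μ.op` for the subspace topology then follows from continuity of the group law, and is not
repeated as a hypothesis.] [cite: Mochizuki2012, §0 p.33] -/
def PartialMul.IsTopologicalPseudoMonoid [TopologicalSpace P] (μ : PartialMul P) : Prop :=
  ∃ (M : Type u) (_ : CommGroup M) (_ : TopologicalSpace M) (_ : IsTopologicalGroup M) (ι : P → M),
    IsEmbedding ι ∧ μ.IsRealizedBy M ι

/-- "Every topological pseudo-monoid determines, in an evident fashion, an underlying
pseudo-monoid" (IUTchI §0 p. 33): forget the topologies. [cite: Mochizuki2012, §0 p.33] -/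
theorem PartialMul.IsTopologicalPseudoMonoid.isPseudoMonoid [TopologicalSpace P]
    {μ : PartialMul P} (h : μ.IsTopologicalPseudoMonoid) : μ.IsPseudoMonoid := by
  obtain ⟨M, _, _, _, ι, -, hι⟩ := h
  exact ⟨M, inferInstance, ι, hι⟩

/-- The pseudo-monoid `P` is *divisible* if `M` and `ι` may be taken such that, for each
positive integer `n`, every element of `M` admits an `n`-th root in `M`, and, moreover, an
element `a ∈ M` lies in `ι(P)` if and only if `aⁿ` lies in `ι(P)` (IUTchI §0 p. 33).
[cite: Mochizuki2012, §0 p.33] -/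
def PartialMul.IsDivisible (μ : PartialMul P) : Prop :=
  ∃ (M : Type u) (_ : CommGroup M) (ι : P → M), μ.IsRealizedBy M ι ∧
    ∀ n : ℕ, 0 < n →
      (∀ a : M, ∃ b : M, b ^ n = a) ∧ (∀ a : M, a ∈ Set.range ι ↔ a ^ n ∈ Set.range ι)

/-- The group `ℚ/ℤ`, written multiplicatively (the shape required of the torsion of `M` for a
cyclotomic pseudo-monoid, IUTchI §0 p. 33). [cite: Mochizuki2012, §0 p.33] -/
abbrev QModZ : Type := Multiplicative (ℚ ⧸ AddSubgroup.zmultiples (1 : ℚ))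

/-- The pseudo-monoid `P` is *cyclotomic* if `M` and `ι` may be taken such that the subgroup
`μ_M ⊆ M` of torsion elements of `M` is isomorphic to `ℚ/ℤ`, `μ_M ⊆ ι(P)`, and
`μ_M · ι(P) ⊆ ι(P)` (IUTchI §0 p. 33). [cite: Mochizuki2012, §0 p.33] -/
def PartialMul.IsCyclotomic (μ : PartialMul P) : Prop :=
  ∃ (M : Type u) (_ : CommGroup M) (ι : P → M), μ.IsRealizedBy M ι ∧
    Nonempty (CommGroup.torsion M ≃* QModZ) ∧
    (CommGroup.torsion M : Set M) ⊆ Set.range ι ∧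
    ∀ t ∈ CommGroup.torsion M, ∀ a ∈ Set.range ι, t * a ∈ Set.range ι

/-- The partial multiplication on a subset `P ⊆ M` of an abelian group obtained by restricting
the group law (the tautological realisation; IUTchI §0 p. 33). [cite: Mochizuki2012, §0 p.33] -/
noncomputable def PartialMul.ofSubset {M : Type u} [CommGroup M] (P : Set M) : PartialMul P where
  dom := {p | (p.1 : M) * p.2 ∈ P}
  op p := ⟨(p.1.1 : M) * p.1.2, p.2⟩

/-- A subset of an abelian group, with the restricted group law, is a pseudo-monoid (realised by
the inclusion). [cite: Mochizuki2012, §0 p.33] -/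
theorem PartialMul.isPseudoMonoid_ofSubset {M : Type u} [CommGroup M] (P : Set M) :
    (PartialMul.ofSubset P).IsPseudoMonoid := by
  refine ⟨M, inferInstance, Subtype.val, ⟨Subtype.val_injective, ?_, fun p => rfl⟩⟩
  ext p
  simp only [PartialMul.ofSubset, Set.mem_setOf_eq, Subtype.range_coe_subtype]

end PseudoMonoids

/-! ### `B^temp(Π)` (p. 34) -/

section BTemp

variable (G : Type u) [Group G] [TopologicalSpace G]

/-- The object property cutting `B^temp(Π)` out of all `Π`-sets: the underlying set is
countable [i.e. of cardinality ≤ that of `ℕ`] and the action is continuous for the DISCRETE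
topology on the set — equivalently, every point stabiliser is open in `Π` (IUTchI §0 p. 34;
[SemiAnbd] §3).  (`Π` is a reserved token in Lean 4; topological groups are called `G` in
signatures.) [cite: Mochizuki2012, §0 p.34] -/
def bTempProperty : ObjectProperty (Action (Type w) G) := fun X =>
  Countable X.V ∧ ∀ x : X.V, IsOpen {g : G | X.ρ g x = x}

/-- `B^temp(Π)`: the category whose objects are countable discrete sets equipped with a
continuous `Π`-action and whose morphisms are morphisms of `Π`-sets (IUTchI §0 p. 34;
[SemiAnbd] §3), as a full subcategory of Mathlib's `Action (Type w) Π`.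
TODO-merge:abc-iut-L3-t2 ([SemiAnbd] §3 owner). [cite: Mochizuki2012, §0 p.34] -/
abbrev BTemp : Type (max u (w + 1)) := (bTempProperty.{w} G).FullSubcategory

variable {G} {H : Type u} [Group H] [TopologicalSpace H]

/-- Pulling a `Π₂`-set back along a continuous homomorphism `f : Π₁ → Π₂` preserves membership
in `B^temp`: countability is untouched and stabilisers pull back to open subgroups.  This is the
object part of the map (a) → (b) recalled on IUTchI §0 p. 35 ([SemiAnbd] Prop. 3.2).
[cite: Mochizuki2012, §0 p.35] -/
theorem bTempProperty_res (f : G →* H) (hf : Continuous f) (X : Action (Type w) H)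
    (hX : bTempProperty.{w} H X) : bTempProperty.{w} G ((Action.res (Type w) f).obj X) := by
  refine ⟨hX.1, fun x => ?_⟩
  exact (hX.2 x).preimage hf

/-- The pull-back functor `f^* : B^temp(Π₂) → B^temp(Π₁)` of a continuous homomorphism
`f : Π₁ → Π₂` (IUTchI §0 p. 35, the passage from (a) to (b); [SemiAnbd] Remark 3.1.2).
[cite: Mochizuki2012, §0 p.35] -/
def BTemp.res (f : G →* H) (hf : Continuous f) : BTemp.{w} H ⥤ BTemp.{w} G :=
  ObjectProperty.lift _ ((bTempProperty.{w} H).ι ⋙ Action.res (Type w) f)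
    fun X => bTempProperty_res f hf X.obj X.property

end BTemp

/-! ### Tempered groups and connected temperoids (p. 34) -/

section Tempered

/-- An inverse system of SURJECTIONS of countable [discrete] groups indexed by a directed
preorder — the shape of system whose inverse limits are the tempered groups (IUTchI §0 p. 34;
[SemiAnbd] Def. 3.1 (i)). [cite: Mochizuki2012, §0 p.34] -/
structure SurjectiveSystem : Type (u + 1) where
  /-- the index preorder -/
  J : Type u
  /-- its order -/
  [preorder : Preorder J]
  /-- directedness -/
  [directed : IsDirected J (· ≤ ·)]
  /-- nonemptiness of the index set -/
  [nonempty : Nonempty J]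
  /-- the groups `G_j` -/
  obj : J → Type u
  /-- group structures -/
  [group : ∀ j, Group (obj j)]
  /-- each `G_j` is countable -/
  [countable : ∀ j, Countable (obj j)]
  /-- transition homomorphisms `G_j → G_i` for `i ≤ j` -/
  map : ∀ ⦃i j : J⦄, i ≤ j → obj j →* obj i
  /-- identities -/
  map_id : ∀ (j : J) (x : obj j), map (le_refl j) x = x
  /-- composition -/
  map_comp : ∀ ⦃i j k : J⦄ (hij : i ≤ j) (hjk : j ≤ k) (x : obj k),
    map hij (map hjk x) = map (hij.trans hjk) x
  /-- the transition maps are surjective -/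
  map_surjective : ∀ ⦃i j : J⦄ (h : i ≤ j), Function.Surjective (map h)

namespace SurjectiveSystem

variable (S : SurjectiveSystem.{u})

/-- The index preorder of a surjective system. [cite: Mochizuki2012, §0 p.34] -/
instance instPreorderJ : Preorder S.J := S.preorder

/-- The index preorder is directed. [cite: Mochizuki2012, §0 p.34] -/
instance instIsDirectedJ : IsDirected S.J (· ≤ ·) := S.directed

/-- The index preorder is nonempty. [cite: Mochizuki2012, §0 p.34] -/
instance instNonemptyJ : Nonempty S.J := S.nonempty

/-- Each `G_j` is a group. [cite: Mochizuki2012, §0 p.34] -/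
instance instGroupObj (j : S.J) : Group (S.obj j) := S.group j

/-- Each `G_j` is countable. [cite: Mochizuki2012, §0 p.34] -/
instance instCountableObj (j : S.J) : Countable (S.obj j) := S.countable j

/-- Each `G_j` carries the discrete topology. [cite: Mochizuki2012, §0 p.34] -/
instance instTopologicalSpaceObj (j : S.J) : TopologicalSpace (S.obj j) := ⊥

/-- Each `G_j` is discrete. [cite: Mochizuki2012, §0 p.34] -/
instance instDiscreteTopologyObj (j : S.J) : DiscreteTopology (S.obj j) := ⟨rfl⟩

/-- The inverse limit `lim G_j ⊆ ∏ G_j`: compatible families (IUTchI §0 p. 34).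
[cite: Mochizuki2012, §0 p.34] -/
def limit : Subgroup (∀ j, S.obj j) where
  carrier := {x | ∀ ⦃i j : S.J⦄ (h : i ≤ j), S.map h (x j) = x i}
  one_mem' := fun i j h => by simp
  mul_mem' := fun {x y} hx hy i j h => by simp only [Pi.mul_apply, map_mul, hx h, hy h]
  inv_mem' := fun {x} hx i j h => by simp only [Pi.inv_apply, map_inv, hx h]

/-- The inverse limit with its limit topology (subspace of the product of discrete spaces) is a
topological group. [cite: Mochizuki2012, §0 p.34] -/
instance : IsTopologicalGroup S.limit := inferInstance

end SurjectiveSystem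

/-- A topological group `Π` is *tempered* if it may be written as an inverse limit of an inverse
system of surjections of countable discrete topological groups (IUTchI §0 p. 34; [SemiAnbd]
Def. 3.1 (i)): it is isomorphic, as a topological group, to `lim G_j` for some
`SurjectiveSystem`.  TODO-merge:abc-iut-L3-t2. [cite: Mochizuki2012, §0 p.34] -/
def IsTempered (G : Type u) [Group G] [TopologicalSpace G] : Prop :=
  ∃ S : SurjectiveSystem.{u}, Nonempty (G ≃ₜ* S.limit)

/-- A tempered group is *Galois-countable* if its topology admits a countable basis (IUTchI
Remark 2.5.3 (i) (T1), p. 52; used in §0 p. 34). [cite: Mochizuki2012, Rmk 2.5.3(i)(T1) p.52] -/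
def IsGaloisCountable (G : Type u) [Group G] [TopologicalSpace G] : Prop :=
  IsTempered G ∧ SecondCountableTopology G

/-- A category `C` is a *connected temperoid* if it is equivalent to a category of the form
`B^temp(Π)` with `Π` a tempered topological group (IUTchI §0 p. 34; [SemiAnbd] Def. 3.1 (ii)).
The group `Π` and the `Π`-sets are taken in the universes `u`, `w`.  TODO-merge:abc-iut-L3-t2.
[cite: Mochizuki2012, §0 p.34] -/
def IsConnectedTemperoid (C : Type v) [Category.{w} C] : Prop :=
  ∃ (G : Type u) (_ : Group G) (_ : TopologicalSpace G) (_ : IsTopologicalGroup G),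
    IsTempered G ∧ Nonempty (C ≌ BTemp.{w} G)

/-- A connected temperoid is *Galois-countable* if it arises from a Galois-countable tempered
group (IUTchI Remark 2.5.3 (i) (T1), p. 52). [cite: Mochizuki2012, Rmk 2.5.3(i)(T1) p.52] -/
def IsGaloisCountableTemperoid (C : Type v) [Category.{w} C] : Prop :=
  ∃ (G : Type u) (_ : Group G) (_ : TopologicalSpace G) (_ : IsTopologicalGroup G),
    IsGaloisCountable G ∧ Nonempty (C ≌ BTemp.{w} G)

/-- A Galois-countable connected temperoid is a connected temperoid.
[cite: Mochizuki2012, Rmk 2.5.3(i)(T1) p.52] -/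
theorem IsGaloisCountableTemperoid.isConnectedTemperoid {C : Type v} [Category.{w} C]
    (h : IsGaloisCountableTemperoid.{w, v, u} C) : IsConnectedTemperoid.{w, v, u} C := by
  obtain ⟨G, _, _, _, hG, e⟩ := h
  exact ⟨G, inferInstance, inferInstance, inferInstance, hG.1, e⟩

end Tempered

/-! ### Morphisms of connected temperoids (p. 35) -/

section TemperoidMorphisms

variable {C₁ : Type v} [Category.{w} C₁] {C₂ : Type v} [Category.{w} C₂]

/-- The functors `C₂ → C₁` that underlie morphisms of connected temperoids `C₁ → C₂`: those that
preserve finite limits and countable colimits (IUTchI §0 p. 35).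
[cite: Mochizuki2012, §0 p.35] -/
structure IsTemperoidMorphismFunctor (F : C₂ ⥤ C₁) : Prop where
  /-- finite limits are preserved -/
  preservesFiniteLimits : Limits.PreservesFiniteLimits F
  /-- colimits indexed by countable categories are preserved -/
  preservesCountableColimits :
    ∀ (J : Type) [SmallCategory J] [CountableCategory J], Limits.PreservesColimitsOfShape J F

/-- Isomorphism of functors as a setoid on the admissible functors `C₂ → C₁`.
[cite: Mochizuki2012, §0 p.35] -/
def temperoidFunctorSetoid (C₁ : Type v) [Category.{w} C₁] (C₂ : Type v) [Category.{w} C₂] :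
    Setoid {F : C₂ ⥤ C₁ // IsTemperoidMorphismFunctor F} where
  r F F' := Nonempty (F.1 ≅ F'.1)
  iseqv :=
    { refl := fun F => ⟨Iso.refl F.1⟩
      symm := fun ⟨i⟩ => ⟨i.symm⟩
      trans := fun ⟨i⟩ ⟨j⟩ => ⟨i.trans j⟩ }

/-- A *morphism of connected temperoids* `C₁ → C₂`: an isomorphism class of functors `C₂ → C₁`
that preserve finite limits and countable colimits (IUTchI §0 p. 35; note the direction, and
that this "differs — but only slightly! — from [SemiAnbd] Def. 3.1 (iii)", where a morphism is a
functor rather than an isomorphism class). [cite: Mochizuki2012, §0 p.35] -/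
def TemperoidHom (C₁ : Type v) [Category.{w} C₁] (C₂ : Type v) [Category.{w} C₂] :
    Type (max v w) :=
  Quotient (temperoidFunctorSetoid C₁ C₂)

/-- The morphism of connected temperoids determined by an admissible functor.
[cite: Mochizuki2012, §0 p.35] -/
def TemperoidHom.mk (F : C₂ ⥤ C₁) (hF : IsTemperoidMorphismFunctor F) : TemperoidHom C₁ C₂ :=
  Quotient.mk _ ⟨F, hF⟩

/-- Two admissible functors define the same morphism of connected temperoids iff they are
isomorphic. [cite: Mochizuki2012, §0 p.35] -/
theorem TemperoidHom.mk_eq_mk_iff (F F' : C₂ ⥤ C₁) (hF : IsTemperoidMorphismFunctor F)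
    (hF' : IsTemperoidMorphismFunctor F') :
    TemperoidHom.mk F hF = TemperoidHom.mk F' hF' ↔ Nonempty (F ≅ F') :=
  Quotient.eq (r := temperoidFunctorSetoid C₁ C₂)

end TemperoidMorphisms

end Literature.IUT.HodgeTheaters
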